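import Summits.BirchSwinnertonDyer.BirchSwinnertonDyer.Theses.PrintX10b
import Summits.BirchSwinnertonDyer.BirchSwinnertonDyer.Theorems.PrintX10bHowardRoad
import Literature.NumberTheory.EllipticCurves.IwasawaAlgebraProofs
import Literature.NumberTheory.EllipticCurves.CyclotomicIwasawaMainTheoremIrreducibleProofs
import Mathlib.RingTheory.UniqueFactorizationDomain.Multiplicity
import HarnessLib

/-!
# Line `congruent-partner-mu-x10b` on crux stmt-BirchSwinnertonDyer-23729 `HowardContainmentAnyClassNumberX10b`
(route PrintX10b rev 19–23 = A₃, aside since rev 22 — the live deciding re-type is stmt-26623, concluded below too; registry crux decl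
`Summit.BirchSwinnertonDyer.BirchSwinnertonDyer.Theses.PrintX10b.HowardContainmentAnyClassNumberX10b`;
seat bsd-idea-5 g3, lens «transfer»; BSD is not proved by any of this; NOT registered (W-79: the line of
record `torsion_depth_x10b` is seated), published as a crux workfile only).

HORIZONTAL TRANSFER: `μ = 0` IS A PROPERTY OF THE RESIDUAL REPRESENTATION, SO PROVE IT ON A CONGRUENT
PARTNER CURVE WHERE IT IS A FINITE-LEVEL FACT. The twin lines isolate the crux's beyond-print core as
`μ(𝔛_{Λ-tors}(E/K_∞^{ac})) = 0` at `3 ∣ h_K` (`mu_isolation_x10b`: `Stmt.muZero`; here restricted to (irr_K) frames as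
`Stmt.muZeroIrrK`); all existing lines
attack it VERTICALLY (up the anticyclotomic tower of `E` itself: Howard's Thm. 2.2.10 at torsion depth
`δ`, scalar Kolyvagin systems, `μ`-isolation). This line attacks it SIDEWAYS, in the family of elliptic
curves `E'/ℚ` with `E'[3] ≅ E[3]` as Galois modules (the Rubin–Silverberg family `X_E(3) ≅ ℙ¹`, infinitely
many members):

* `stub_residualMuInvariance` — Hatley–Lei 2019 (MRL; arXiv:1706.04531) Prop. 4.2 / Thm. 4.3 for the
  Selmer structure `𝓛 = (Gr, Gr)` (ordinary at both `v`, `v̄`), PORTED to `p = 3`, any `h_K`, `2`-group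
  image: for congruent good-ordinary Heegner curves `E`, `E'` over the same `K`, `μ(𝔛'_{tors}) = 0 ⇒
  μ(𝔛_{tors}) = 0`. Mechanism (Greenberg–Vatsal over `K_∞^{ac}`): the imprimitive RESIDUAL Selmer groups
  `Sel^{S}(K_∞, E[3]) = Sel^{S}(K_∞, E'[3])` coincide inside `H¹(K_∞, E[3])`, and
  `corank_{𝔽₃⟦T⟧} Sel^{S}(K_∞, E[3]) = rank_Λ 𝔛 + #{μ-summands of 𝔛}`; both `Λ`-ranks are `1`
  (Cornut–Vatsal + the Kolyvagin bound `⊗ ℚ₃`, CGLS 2022 Thm. 4.1.1 — any `h_K`, no big image), so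
  `μ(𝔛) = 0 ⟺ μ(𝔛') = 0`. What does NOT transfer from print: Hatley–Lei's standing (admiss.) comes from
  Longo–Vigni and contains `p ∤ 6Nφ(N)h_K` — BOTH `p = 3` and `3 ∣ h_K` are outside; the port replaces the
  Hida-family structure theorem (their Thm. 3.5) by the rank-one statement for each curve separately. All bad
  primes of `E`, `E'` split in `K` (Heegner for `N` and `N'`), so they are finitely decomposed in `K_∞^{ac}`
  and imprimitivity costs no `μ` (`N⁻ = 1` exactly as in Hatley–Lei).
* `stub_cofreeCertificate` — the finite-level certificate replacing Matar 2018 (whose criterion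
  `p ∤ #Ẽ(𝔽_p) ∧ a_p ≢ 2 (mod p)` is VACUOUS at `p = 3`: for `3`-ordinary `a₃ ∈ {±1, ±2}` one has
  `3 ∤ #Ẽ(𝔽₃) ⟺ a₃ ≡ 2 (mod 3)` — the first non-transferring step, replaced here): if `E'/ℚ` is good
  ordinary NON-ANOMALOUS at `p` (`p ∤ a_p - 1`), `ρ̄_{E',p}` irreducible, `p ∤ ∏ c_ℓ(E')`, `p` split in `K`,
  `d_K ∉ {-3,-4}`, and the Heegner point `y'_K ∈ E'(K)` is not divisible by `p` in `E'(K)/tors`, then EVERY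
  Selmer dual `𝔛'` of `E'/K_∞^{ac}` has `μ(𝔛'_{tors}) = 0` — indeed `𝔛' ≅ Λ`: Kolyvagin at finite level
  with Jetchev's improvement at `p ∣ [E'(K):ℤy'_K]`-free case / Matar–Nekovář 2019 Thm. 6.7 (small image at
  `3` allowed, irreducible suffices) gives `rank E'(K) = 1`, `Ш(E'/K)[p] = 0`, so `Sel_{p^∞}(E'/K) ≅ ℚ_p/ℤ_p`;
  exact control at the bottom layer (Greenberg: no error for `E'(K)[p] = 0`, `p ∤ c_ℓ`, non-anomalous at the
  split primes above `p`, `K_∞/K` unramified outside `p`) gives `𝔛'/T𝔛' ≅ ℤ_p`, hence `𝔛'` cyclic, and of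
  rank one, hence `≅ Λ`.
* `stub_partnerExists_nonanomalous` — THE NEW ARITHMETIC-STATISTICS CRUX: every non-CM X10b Heegner frame
  `(E, K)` with `E` non-anomalous at `3` admits a congruent partner `E'` (`E'[3] ≅ E[3]`, good ordinary at
  `3`, Heegner for `K`) carrying the certificate. Non-anomalousness, ordinarity and `ρ̄` are residual
  invariants, so only `p ∤ ∏ c_ℓ(E')` and the `3`-indivisibility of `y'_K` vary in the family; by
  Gross–Zagier + `3`-part BSD heuristics this is the generic behaviour, and each instance is a finite
  computation — but no theorem in print guarantees a member. Why it might fail: a frame all of whose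
  congruent Heegner partners have `3 ∣ [E'(K) : ℤ y'_K]·∏ c_ℓ` (a residually forced `3`-divisibility,
  e.g. through a degree-`3`-isogenous... impossible here as `ρ̄` is irreducible — the honest risk is a
  residually constant Tamagawa factor `c_ℓ ≡ 0 (mod 3)` at a prime `ℓ` of split multiplicative type forced by
  `ρ̄|G_{ℚ_ℓ}`).
* `stub_partnerMuZero_anomalous` — the ANOMALOUS class (`3 ∣ a₃ - 1`, i.e. `a₃ ∈ {1,-2}`, a residual
  invariant so no partner escapes it): some congruent good-ordinary Heegner partner has `μ = 0`. BEYOND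
  PRINT: needs an anomalous certificate (exact control then has a local error at `v ∣ 3` killed iff
  `red_v(y'_K)` generates `Ẽ'(𝔽_v)[3^∞]`), or a CM partner (`ℚ(√-2)`, `ℚ(√-11)` have `3` split) via
  Rubin / Agboola–Howard. This is the line's residue and is flagged as such.
* `stub_residue_thetaFromK` — DECLARED RESIDUE shared letter for letter with the twin line
  `greenberg_descent_mu_x10b`: the crux's own conclusions on the frames where `E[3]` is a REDUCIBLE
  `G_K`-module (`E` congruent to a theta series from `K`; `im ρ̄ = N(C_s(3))`, `K` = the split-Cartan
  field). Finding of this seat (g3): there `μ(𝔛_tors) ≥ 1` is EXPECTED when the residual character lifts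
  to a self-dual Grössencharacter with root number `-1` (Agboola–Howard corank `1` ⇒ residual Greenberg
  corank `≥ 1` ⇒ `μ(X_Gr) ≥ 1` ⇒ `μ(𝔛_tors) ≥ 1` once `μ(𝓛^{BDP}) = 0`), so NO congruent partner with
  `μ = 0` can exist there (by the invariance stub itself!) and idea-16's unrestricted `Stmt.muZero` is a
  disproof target; the partner stubs therefore carry the binder (irr_K) =
  `(W.baseChange K).HasIrreducibleModPGaloisRep 3`, exactly B₃'s (stmt-26622) binder, which A₃ lacks.
* `stub_pLocalizedContainment` — SHARED with `mu_isolation_x10b` (identical signature): the containment at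
  height-one primes `≠ (3)` (CGS 2025 Thm. 6.5.2 road).

Composition (kernel-checked, no `sorry` outside `stub_*`): on (irr_K) frames, by cases on anomalousness,
partner + certificate (or the anomalous stub) + invariance ⇒ `Stmt.muZeroIrrK` (idea-16's `Stmt.muZero`
WITH the binder (irr_K)) ⇒ with the localized containment and `(3)`-saturation in the UFD `Λ` ⇒ the crux's
conclusion; on reducible-over-`K` frames the residue stub; together the crux BY NAME (by cases on (irr_K)).

References: [HatleyLei2019MRL] Prop. 4.2, Thm. 4.3, Thm. 4.4 (arXiv:1706.04531 p. 11); [GreenbergVatsal2000]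
Thm. 1.4 (cyclotomic prototype); [EmertonPollackWeston2006] Thm. 1; [Matar2018IJNT] (IJNT 14, 1279–1304);
[MatarNekovar2019] Thm. 6.7; [Jetchev2008] Thm. 1.1; [AgboolaHoward2006] Thm. A;
[Hsieh2014RankinSelberg] Thm. B hypotheses (arXiv:1112.1580 p. 4); [Hsieh2014CMmu] Thm. 1–2 (arXiv:1112.1574 pp. 3–4); [Greenberg1999LNM] Prop. 3.7–3.9 (control);
[RubinSilverberg1995] Thm. 1 (families with constant `E[3]`, `X_E(3) ≅ ℙ¹`); [CornutVatsal2005];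
[CastellaGrossiLeeSkinner2022] Thm. 4.1.1; [CastellaGrossiSkinner2025] Thm. 6.5.2; [MastellaZerman2026] Cor. 4.6;
[Howard2004HeegnerKolyvagin] Thm. B, Thm. 2.2.10; [PollackWeston2011] Thm. 1.1 (why the definite/level-raising
version is dead at 3: admissible primes, `NoAdmissiblePrimesAtThree`).
-/

set_option linter.dupNamespace false

noncomputable section

open scoped Classical

open WeierstrassCurve NumberField Field Literature.NumberTheory.EllipticCurves
  Literature.NumberTheory.EllipticCurves.ModularForms
open Literature.NumberTheory.EllipticCurves.Rank1Residual (ClassX10 Surj)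

namespace Summit.BirchSwinnertonDyer.BirchSwinnertonDyer.Cruxes.HowardContainmentAnyClassNumberX10b.CongruentPartnerMuX10b

/-! ## Shared statements (identical, letter for letter, to `mu_isolation_x10b`) -/

/-- **The containment in `Λ[1/3]`** — SHARED stub, verbatim the signature of
`MuIsolationX10b.Stmt.stub_pLocalizedContainment` (same item by normalised signature).
[cite: CastellaGrossiSkinner2025, Thm. 6.5.2 (arXiv:2303.04373)]
[cite: CastellaGrossiLeeSkinner2022, Thm. 4.1.1 and Rem. 4.1.4 (arXiv:2008.02571)] -/
def Stmt.stub_pLocalizedContainment : Prop :=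
    ∀ (W : WeierstrassCurve ℚ) [W.IsElliptic] [W.IsGloballyMinimal] (p : ℕ) [Fact p.Prime]
      [NeZero (W.conductorNorm ℤ)] (K : Type) [Field K] [NumberField K],
      ClassX10 W p → ¬ Surj W 3 → ¬ W.HasCM →
      IsImaginaryQuadratic K → NumberField.discr K ≠ -3 → NumberField.discr K ≠ -4 →
      SatisfiesHeegnerHypothesis (W.conductorNorm ℤ) K → SatisfiesHeegnerHypothesis p K →
      ∀ (κ : ZpExtension K p), κ.IsAnticyclotomic → ∀ (γ : Field.absoluteGaloisGroup K),
      κ.IsTopGenerator γ →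
      ∀ (jbar : AlgebraicClosure K →+* ℂ) (D : (W.baseChange K).LambdaAdicSelmerData κ γ)
        (F : HeegnerFamily (W.conductorNorm ℤ) W K κ jbar) (X : (W.baseChange K).SelmerDualData κ γ),
      ∃ m : ℕ,
        IwasawaAlgebra.augIdealP p ^ m * heegnerCharIdeal D F ^ 2 ≤
          Module.charIdeal (IwasawaAlgebra p) (Submodule.torsion (IwasawaAlgebra p) X.X)

/-- **`μ(𝔛_{Λ-tors}) = 0` on non-CM X10b Heegner frames WITH `E[3]` AN IRREDUCIBLE `G_K`-MODULE** — the
transferred target: idea-16's `MuIsolationX10b.Stmt.muZero` with the extra binder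
`(W.baseChange K).HasIrreducibleModPGaloisRep p` (irr_K). NOT a stub of this line (proved below from the
line's stubs). The unrestricted `Stmt.muZero` is deliberately NOT asserted: on reducible-over-`K` frames it is
this seat's disproof target (see `Stmt.stub_residue_thetaFromK`). [cite: MastellaZerman2026, Cor. 4.6]
[cite: BurungaleCastellaSkinner2025, Prop. 4.2.2 (the (irr_K) of the analytic μ = 0)] -/
def Stmt.muZeroIrrK : Prop :=
    ∀ (W : WeierstrassCurve ℚ) [W.IsElliptic] [W.IsGloballyMinimal] (p : ℕ) [Fact p.Prime]
      [NeZero (W.conductorNorm ℤ)] (K : Type) [Field K] [NumberField K],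
      ClassX10 W p → ¬ Surj W 3 → ¬ W.HasCM →
      IsImaginaryQuadratic K → NumberField.discr K ≠ -3 → NumberField.discr K ≠ -4 →
      SatisfiesHeegnerHypothesis (W.conductorNorm ℤ) K → SatisfiesHeegnerHypothesis p K →
      (W.baseChange K).HasIrreducibleModPGaloisRep p →
      ∀ (κ : ZpExtension K p), κ.IsAnticyclotomic → ∀ (γ : Field.absoluteGaloisGroup K),
      κ.IsTopGenerator γ → ∀ (X : (W.baseChange K).SelmerDualData κ γ),
      ¬ Module.charIdeal (IwasawaAlgebra p) (Submodule.torsion (IwasawaAlgebra p) X.X) ≤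
          IwasawaAlgebra.augIdealP p

/-! ## The line's own vocabulary -/

/-- **`E[p] ≅ E'[p]` as `G_ℚ`-modules** (residual congruence of two elliptic curves over `ℚ`): a
`Γ_ℚ`-equivariant additive isomorphism of the geometric `p`-torsion (same shape as the hypothesis of the
tree's `HatleyLei2019.signedSelmer_congruent_mu_eq`). [folklore] -/
def Stmt.Congruent (W W' : WeierstrassCurve ℚ) (p : ℕ) : Prop :=
    ∃ e : geomTorsion W (p : ℤ) ≃+ geomTorsion W' (p : ℤ),
      ∀ (σ : Field.absoluteGaloisGroup ℚ) (P : geomTorsion W (p : ℤ)), e (σ • P) = σ • e P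

/-- **`μ(𝔛_{Λ-tors}(V/K_∞)) = 0` for every Selmer dual datum** of the curve `V/ℚ` over the tower of `κ`
(`char_Λ` of the `Λ`-torsion not contained in `(p)`). [folklore] -/
def Stmt.MuZeroAt (V : WeierstrassCurve ℚ) (p : ℕ) [Fact p.Prime] (K : Type) [Field K] [NumberField K]
    (κ : ZpExtension K p) (γ : Field.absoluteGaloisGroup K) : Prop :=
    ∀ (X : (V.baseChange K).SelmerDualData κ γ),
      ¬ Module.charIdeal (IwasawaAlgebra p) (Submodule.torsion (IwasawaAlgebra p) X.X) ≤
          IwasawaAlgebra.augIdealP p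

/-- **The cofree certificate of a partner curve `E'/ℚ` relative to `(p, K)`**: good ordinary
NON-ANOMALOUS reduction at `p` (`p ∤ a_p(E')`, `p ∤ a_p(E') - 1`), `ρ̄_{E',p}` irreducible, the Heegner
hypothesis for `(N_{E'}, K)`, `p ∤ c_ℓ(E')` for every prime `ℓ`, and a Heegner point `y'_K ∈ E'(K)` (for a
modular parametrisation of degree-constant `c` prime to `p`) that is NOT divisible by `p` modulo torsion.
Each clause is a finite computation for a given `E'`. [folklore] -/
def Stmt.CofreeCertificate (W' : WeierstrassCurve ℚ) [W'.IsElliptic] [W'.IsGloballyMinimal] (p : ℕ)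
    [Fact p.Prime] [NeZero (W'.conductorNorm ℤ)] (K : Type) [Field K] [NumberField K] : Prop :=
    W'.HasGoodReductionAtPrime p ∧ ¬ (p : ℤ) ∣ W'.frobeniusTrace p ∧ ¬ (p : ℤ) ∣ W'.frobeniusTrace p - 1 ∧
    W'.HasIrreducibleModPGaloisRep p ∧ SatisfiesHeegnerHypothesis (W'.conductorNorm ℤ) K ∧
    (∀ (ℓ : ℕ) [Fact ℓ.Prime], ¬ p ∣ (W'.baseChange ℚ_[ℓ]).localTamagawaNumber ℤ_[ℓ]) ∧
    ∃ (Dt' : ModularParametrizationData W' (W'.conductorNorm ℤ))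
      (H' : HeegnerDatum (W'.conductorNorm ℤ) (NumberField.discr K)) (ιC : K →+* ℂ)
      (P' : (W'.baseChange K).toAffine.Point),
      ¬ (p : ℤ) ∣ Dt'.c ∧
      WeierstrassCurve.Affine.Point.map ιC.toRatAlgHom P' = ModularForms.heegnerPointComplex Dt' H' ∧
      ∀ Q : (W'.baseChange K).toAffine.Point, ¬ IsOfFinAddOrder (P' - p • Q)

/-! ## Stub statements -/

/-- **Residual invariance of `μ = 0` (Hatley–Lei Prop. 4.2 / Thm. 4.3 for `𝓛 = (Gr,Gr)`, ported to `p = 3`,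
any class number, any image with `ρ̄` irreducible).** For two elliptic curves `E, E'/ℚ`, both good ordinary at
the odd prime `p`, with `E[p] ≅ E'[p]` as `G_ℚ`-modules and `ρ̄` irreducible, an imaginary quadratic `K`
(`d_K ∉ {-3,-4}`) in which `p` splits and which is Heegner for BOTH conductors, and the anticyclotomic
`ℤ_p`-tower: `μ = 0` for (every Selmer dual of) `E'` implies `μ = 0` for (every Selmer dual of) `E`.
PRINT-ASSEMBLABLE, not by name: residual Selmer groups coincide; `rank_{𝔽_p⟦T⟧}(𝔛/p) = rank_Λ 𝔛 + #μ`;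
both `Λ`-ranks equal `1` (Cornut–Vatsal + Kolyvagin `⊗ ℚ_p`: CGLS Thm. 4.1.1 / Howard Thm. B(a), any `h_K`);
bad primes split in `K` hence finitely decomposed (no `μ` from imprimitivity). Why it might fail: the port of
Hatley–Lei's Lemma 3.6 / (H.div)-type local conditions at `p = 3` when `E(K_{∞,w})[3] ≠ 0` for `w ∣ 3`
(anomalous primes change the residual local condition at `w`; handled in HL by Greenberg's `𝓛_w`-comparison,
to be re-checked at `3`). [cite: HatleyLei2019MRL, Prop. 4.2 and Thm. 4.3 (arXiv:1706.04531 p. 11)]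
[cite: GreenbergVatsal2000, Thm. 1.4] [cite: CastellaGrossiLeeSkinner2022, Thm. 4.1.1]
[cite: Howard2004HeegnerKolyvagin, Thm. B (a)] [cite: CornutVatsal2005, Thm. 1.5] -/
def Stmt.stub_residualMuInvariance : Prop :=
    ∀ (W W' : WeierstrassCurve ℚ) [W.IsElliptic] [W.IsGloballyMinimal] [W'.IsElliptic]
      [W'.IsGloballyMinimal] (p : ℕ) [Fact p.Prime] [NeZero (W.conductorNorm ℤ)]
      [NeZero (W'.conductorNorm ℤ)] (K : Type) [Field K] [NumberField K],
      p ≠ 2 →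
      W.HasGoodReductionAtPrime p → ¬ (p : ℤ) ∣ W.frobeniusTrace p →
      W'.HasGoodReductionAtPrime p → ¬ (p : ℤ) ∣ W'.frobeniusTrace p →
      W.HasIrreducibleModPGaloisRep p → Stmt.Congruent W W' p →
      IsImaginaryQuadratic K → NumberField.discr K ≠ -3 → NumberField.discr K ≠ -4 →
      SatisfiesHeegnerHypothesis (W.conductorNorm ℤ) K → SatisfiesHeegnerHypothesis (W'.conductorNorm ℤ) K →
      SatisfiesHeegnerHypothesis p K →
      ∀ (κ : ZpExtension K p), κ.IsAnticyclotomic → ∀ (γ : Field.absoluteGaloisGroup K),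
      κ.IsTopGenerator γ →
      Stmt.MuZeroAt W' p K κ γ → Stmt.MuZeroAt W p K κ γ

/-- **The cofree criterion (finite-level Kolyvagin + exact control ⇒ `𝔛' ≅ Λ` ⇒ `μ = 0`).** For `E'/ℚ` with
the certificate `Stmt.CofreeCertificate` relative to an odd prime `p` split in the imaginary quadratic `K`
(`d_K ∉ {-3,-4}`), every Selmer dual `𝔛'` of `E'` over the anticyclotomic `ℤ_p`-tower has `μ(𝔛'_{tors}) = 0`.
PRINT-ASSEMBLABLE: `y'_K ∉ pE'(K) + tors` and Jetchev–Kolyvagin / Matar–Nekovář Thm. 6.7 (`ρ̄` irreducible,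
not necessarily surjective — the X10b point) give `E'(K) ⊗ ℤ_p = ℤ_p y'_K`, `Ш(E'/K)[p^∞] = 0`; Greenberg's
control theorem at the bottom layer is exact under (`E'(K)[p] = 0`, `p ∤ c_ℓ`, non-anomalous at `v, v̄`), so
`𝔛'_Γ ≅ ℤ_p`, `𝔛'` is cyclic of `Λ`-rank one (Cornut–Vatsal), `𝔛' ≅ Λ`, torsion zero. Why it might fail:
Matar–Nekovář Thm. 6.7 at `p = 3` needs `p ∤ c·(Manin)` and their (irr_K) — supplied by `d_K ≠ -3` and
Prop. 5.26 — but their `Ш` statement is for the `p`-part INDEX `[E'(K):ℤy'_K]`, so `p ∤ index` must follow from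
`p`-indivisibility mod torsion AND `E'(K)[p] = 0` (it does). [cite: MatarNekovar2019, Thm. 6.7 and Prop. 5.26]
[cite: Jetchev2008, Thm. 1.1] [cite: Greenberg1999LNM, Prop. 3.7, 3.8, 3.9 and Lemma 3.4 (anomalous error)]
[cite: CornutVatsal2005, Thm. 1.5] [cite: HatleyLei2019MRL, Thm. 4.4 (= Matar 2018, vacuous at p = 3)] -/
def Stmt.stub_cofreeCertificate : Prop :=
    ∀ (W' : WeierstrassCurve ℚ) [W'.IsElliptic] [W'.IsGloballyMinimal] (p : ℕ) [Fact p.Prime]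
      [NeZero (W'.conductorNorm ℤ)] (K : Type) [Field K] [NumberField K],
      p ≠ 2 → IsImaginaryQuadratic K → NumberField.discr K ≠ -3 → NumberField.discr K ≠ -4 →
      SatisfiesHeegnerHypothesis p K → Stmt.CofreeCertificate W' p K →
      ∀ (κ : ZpExtension K p), κ.IsAnticyclotomic → ∀ (γ : Field.absoluteGaloisGroup K),
      κ.IsTopGenerator γ → Stmt.MuZeroAt W' p K κ γ

/-- **Partner existence in the NON-ANOMALOUS class (the new arithmetic-statistics crux; beyond print).** Every
non-CM X10b Heegner frame `(E, p = 3, K)` (`d_K ∉ {-3,-4}`, `E[3]` an IRREDUCIBLE `G_K`-module = (irr_K); the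
theta-congruent frames are the declared residue `stub_residue_thetaFromK`) with `E` non-anomalous at `3` (`3 ∤ a₃ - 1`) has
a congruent partner `E'/ℚ` (`E'[3] ≅ E[3]` as `G_ℚ`-modules) carrying the cofree certificate relative to
`(3, K)` (good ordinary non-anomalous at `3` and `ρ̄` irreducible are automatic from the congruence; the
content is: Heegner for `K`, `3 ∤ ∏ c_ℓ(E')`, `y'_K` not `3`-divisible mod torsion). Source of partners: the
Rubin–Silverberg family of curves with constant mod-`3` representation (`X_E(3) ≅ ℙ¹_ℚ`, explicit
`E_t : t ∈ ℚ`). Why it might fail: no equidistribution theorem for `3 ∤ [E'(K):ℤy'_K]·∏c_ℓ` in a twist-type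
family is in print (Kriz–Li prove `3`-indivisibility results for quadratic-twist families, not for `X_E(3)`);
a frame whose every partner satisfying Heegner for `K` has `3 ∣ c_ℓ(E')` forced by `ρ̄|G_{ℚ_ℓ}` at some
`ℓ ∣ N` would be a counterexample to the stub AS TYPED (then enlarge the certificate, not the line).
[cite: RubinSilverberg1995, Thm. 1 and §2 (mod-3 families)] [cite: KrizLi2019, Thm. 1.? (3-indivisibility of
Heegner points in families — nearest print)] [cite: HatleyLei2019MRL, §4.2] [cite: GrossZagier1986, Thm. I.6.3] -/
def Stmt.stub_partnerExists_nonanomalous : Prop :=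
    ∀ (W : WeierstrassCurve ℚ) [W.IsElliptic] [W.IsGloballyMinimal] (p : ℕ) [Fact p.Prime]
      [NeZero (W.conductorNorm ℤ)] (K : Type) [Field K] [NumberField K],
      ClassX10 W p → ¬ Surj W 3 → ¬ W.HasCM →
      IsImaginaryQuadratic K → NumberField.discr K ≠ -3 → NumberField.discr K ≠ -4 →
      SatisfiesHeegnerHypothesis (W.conductorNorm ℤ) K → SatisfiesHeegnerHypothesis p K →
      (W.baseChange K).HasIrreducibleModPGaloisRep p →
      ¬ (p : ℤ) ∣ W.frobeniusTrace p - 1 →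
      ∃ (W' : WeierstrassCurve ℚ) (_ : W'.IsElliptic) (_ : W'.IsGloballyMinimal)
        (_ : NeZero (W'.conductorNorm ℤ)),
        Stmt.Congruent W W' p ∧ Stmt.CofreeCertificate W' p K

/-- **The ANOMALOUS class (`3 ∣ a₃ - 1`; the line's flagged residue, beyond print).** Every non-CM X10b
Heegner frame with (irr_K) and `E` anomalous at `3` has SOME congruent partner `E'/ℚ` (`E'[3] ≅ E[3]`), good ordinary at
`3` and Heegner for `K`, all of whose Selmer duals over the anticyclotomic `ℤ₃`-tower have `μ = 0`.
(Anomalousness is a residual invariant, so the partner is anomalous too: a certificate here needs the extra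
local condition "`red_v(y'_K)` generates `Ẽ'(𝔽_v)[3^∞]`" in the control theorem, or a CM partner with
`3` split in its CM field treated by Rubin / Agboola–Howard.) Why it might fail: it is the isolated core
restricted to the anomalous class if no certification mechanism exists there.
[cite: Greenberg1999LNM, Lemma 3.4 and Prop. 3.9 (anomalous local error)] [cite: AgboolaHoward2006, Thm. A]
[cite: HatleyLei2019MRL, Thm. 4.3] [cite: MastellaZerman2026, Cor. 4.6] -/
def Stmt.stub_partnerMuZero_anomalous : Prop :=
    ∀ (W : WeierstrassCurve ℚ) [W.IsElliptic] [W.IsGloballyMinimal] (p : ℕ) [Fact p.Prime]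
      [NeZero (W.conductorNorm ℤ)] (K : Type) [Field K] [NumberField K],
      ClassX10 W p → ¬ Surj W 3 → ¬ W.HasCM →
      IsImaginaryQuadratic K → NumberField.discr K ≠ -3 → NumberField.discr K ≠ -4 →
      SatisfiesHeegnerHypothesis (W.conductorNorm ℤ) K → SatisfiesHeegnerHypothesis p K →
      (W.baseChange K).HasIrreducibleModPGaloisRep p →
      (p : ℤ) ∣ W.frobeniusTrace p - 1 →
      ∃ (W' : WeierstrassCurve ℚ) (_ : W'.IsElliptic) (_ : W'.IsGloballyMinimal)
        (_ : NeZero (W'.conductorNorm ℤ)),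
        Stmt.Congruent W W' p ∧ W'.HasGoodReductionAtPrime p ∧ ¬ (p : ℤ) ∣ W'.frobeniusTrace p ∧
        SatisfiesHeegnerHypothesis (W'.conductorNorm ℤ) K ∧
        ∀ (κ : ZpExtension K p), κ.IsAnticyclotomic → ∀ (γ : Field.absoluteGaloisGroup K),
          κ.IsTopGenerator γ → Stmt.MuZeroAt W' p K κ γ

/-- **DECLARED RESIDUE — the theta-congruent frames.** On the non-CM X10b Heegner frames where `E[3]` is a
REDUCIBLE `G_K`-module (`ρ̄|G_K = θ ⊕ θ^c` with `θ` quadratic; `im ρ̄ = N(C_s(3)) ≅ D₄` and `K` = the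
split-Cartan field of `E`, so `E` is congruent mod `3` to a theta series from `K`), the crux's OWN
conclusions — unpinned (23729) and pinned/tied (26621) — are asserted outright: this line's mechanism
does NOT reach them and claims nothing about them. Reason (finding of this seat): here the Greenberg
transfer is unavailable and `μ = 0` itself is a disproof target. If `θ` is the reduction of a self-dual
Grössencharacter `ψ` of `K` of type `(1,0)` with `W(ψ) = -1` (e.g. `E ≡ A (mod 3)` for `A/ℚ` with CM by
`𝓞_K`, `K ∈ {ℚ(√-2), ℚ(√-11)}`, `h_K = 1`), then `Sel_{𝔭^∞}(A/K_∞^{ac})` has `Λ`-corank `1`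
(Agboola–Howard) for the Selmer structure (`∅` at `𝔭 = v`, `0` at `v̄`) on `A[𝔭] = θ`, which IS the
Greenberg structure; residual Selmer coranks over `K_∞` agree (`θ|G_{K_∞} ≠ 1`; the primes `q ∣ d_K` where
`A` is bad have `H¹(K_w, θ) = 0`; the Heegner primes of `E` are finitely decomposed), so
`corank_{𝔽₃⟦T⟧} Sel_Gr(K_∞, E[3]) ≥ 1`, i.e. `μ(X_Gr(E)) ≥ 1` (`X_Gr(E)` is `Λ`-torsion), and then
`μ(𝔛_tors(E)) = μ(X_Gr(E)) - 2μ(𝓛_v̄^{BDP}(E)) ≥ 1` once `μ(𝓛^{BDP}(E)) = μ(𝓛^{BDP}(A)) = 0` (congruent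
`q`-expansions at CM points; CM factorisation of `𝓛^{BDP}(A)` into Katz values in the sign-`+1` range,
`μ = 0` by Hsieh 2014 Thm. 1 = Finis 2006 for imaginary quadratic `K`). So on these frames idea-16's
unrestricted `Stmt.muZero` is expected to FAIL while the containment survives with `μ(𝔖/ℋ_F) ≥ 1` —
beyond every printed engine (Howard / MZ26 / CGLS / BCS all carry an irreducibility-over-`K` or scalar
hypothesis; B₃ = stmt-26622 carries (irr_K), A₃ = stmt-26621/23729 does not). Filed so that the
composition is honest about its scope; a prover should NOT attack this stub — the census should decide
whether A₃ wants an (irr_K) binder. Why it might fail: it is the crux on its least-sourced frames.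
[cite: AgboolaHoward2006, Thm. A] [cite: Hsieh2014RankinSelberg, Thm. B hypotheses (arXiv:1112.1580 p. 4)]
[cite: Hsieh2014CMmu, Thm. 1 (arXiv:1112.1574 p. 3)] [cite: Finis2006, Thm. 1.1] [cite: PollackWeston2011, Thm. 1.1 (shape)] -/
def Stmt.stub_residue_thetaFromK : Prop :=
    ∀ (W : WeierstrassCurve ℚ) [W.IsElliptic] [W.IsGloballyMinimal] (p : ℕ) [Fact p.Prime]
      [NeZero (W.conductorNorm ℤ)] (K : Type) [Field K] [NumberField K],
      ClassX10 W p → ¬ Surj W 3 → ¬ W.HasCM →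
      IsImaginaryQuadratic K → NumberField.discr K ≠ -3 → NumberField.discr K ≠ -4 →
      SatisfiesHeegnerHypothesis (W.conductorNorm ℤ) K → SatisfiesHeegnerHypothesis p K →
      ¬ (W.baseChange K).HasIrreducibleModPGaloisRep p →
      ∀ (κ : ZpExtension K p), κ.IsAnticyclotomic → ∀ (γ : Field.absoluteGaloisGroup K),
      κ.IsTopGenerator γ →
      ∀ (Dt : ModularParametrizationData W (W.conductorNorm ℤ))
        (H : HeegnerDatum (W.conductorNorm ℤ) (NumberField.discr K)) (ιC : K →+* ℂ),
      (∃ (jbar : AlgebraicClosure K →+* ℂ) (D : (W.baseChange K).LambdaAdicSelmerData κ γ)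
          (F : HeegnerFamily (W.conductorNorm ℤ) W K κ jbar) (X : (W.baseChange K).SelmerDualData κ γ),
          heegnerCharIdeal D F ^ 2 ≤
            Module.charIdeal (IwasawaAlgebra p) (Submodule.torsion (IwasawaAlgebra p) X.X)) ∧
      (¬ (p : ℤ) ∣ Dt.c →
        ∃ (jbar : AlgebraicClosure K →+* ℂ) (D : (W.baseChange K).LambdaAdicSelmerData κ γ)
          (F : HeegnerFamily (W.conductorNorm ℤ) W K κ jbar) (X : (W.baseChange K).SelmerDualData κ γ),
          F.Dt = Dt ∧ heegnerCharIdeal D F ^ 2 ≤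
            Module.charIdeal (IwasawaAlgebra p) (Submodule.torsion (IwasawaAlgebra p) X.X))

/-! ## The stubs (the ONLY sorries of the file) -/

theorem stub_residualMuInvariance : Stmt.stub_residualMuInvariance := by
  sorry

theorem stub_cofreeCertificate : Stmt.stub_cofreeCertificate := by
  sorry

theorem stub_partnerExists_nonanomalous : Stmt.stub_partnerExists_nonanomalous := by
  sorry

theorem stub_partnerMuZero_anomalous : Stmt.stub_partnerMuZero_anomalous := by
  sorry

theorem stub_residue_thetaFromK : Stmt.stub_residue_thetaFromK := by
  sorry

theorem stub_pLocalizedContainment : Stmt.stub_pLocalizedContainment := by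
  sorry

/-! ## `μ(𝔛_tors) = 0` by horizontal transfer (kernel-checked) -/

/-- **Partner + certificate (or the anomalous stub) + residual invariance ⇒ `μ(𝔛_{Λ-tors}(E)) = 0`** on (irr_K) frames.
[folklore] -/
theorem muZeroIrrK_of_partner (hinv : Stmt.stub_residualMuInvariance) (hcert : Stmt.stub_cofreeCertificate)
    (hex : Stmt.stub_partnerExists_nonanomalous) (hanomStub : Stmt.stub_partnerMuZero_anomalous) :
    Stmt.muZeroIrrK := by
  unfold Stmt.stub_residualMuInvariance at hinv
  unfold Stmt.stub_cofreeCertificate at hcert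
  unfold Stmt.stub_partnerExists_nonanomalous at hex
  unfold Stmt.stub_partnerMuZero_anomalous at hanomStub
  intro W _ _ p _ _ K _ _ hX hns hcm hK h3 h4 hHN hHp hirrK κ hκ γ hγ X
  have hp3 : p = 3 := hX.1
  have hp2 : p ≠ 2 := by omega
  have hgo : W.HasGoodReductionAtPrime p ∧ ¬ (p : ℤ) ∣ W.frobeniusTrace p := by
    have h := hX.2.1
    subst hp3
    exact h
  have hirr : W.HasIrreducibleModPGaloisRep p := by
    have h := hX.2.2.1
    subst hp3
    exact h
  by_cases hanom : (p : ℤ) ∣ W.frobeniusTrace p - 1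
  · obtain ⟨W', _, _, _, hcong, hgood', hord', hHN', hμ'⟩ :=
      hanomStub W p K hX hns hcm hK h3 h4 hHN hHp hirrK hanom
    exact hinv W W' p K hp2 hgo.1 hgo.2 hgood' hord' hirr hcong hK h3 h4 hHN hHN' hHp κ hκ γ hγ
      (hμ' κ hκ γ hγ) X
  · obtain ⟨W', _, _, _, hcong, hC⟩ := hex W p K hX hns hcm hK h3 h4 hHN hHp hirrK hanom
    have hμ' : Stmt.MuZeroAt W' p K κ γ := hcert W' p K hp2 hK h3 h4 hHp hC κ hκ γ hγ
    exact hinv W W' p K hp2 hgo.1 hgo.2 hC.1 hC.2.1 hirr hcong hK h3 h4 hHN hC.2.2.2.2.1 hHp κ hκ γ hγ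
      hμ' X

/-! ## The promotion: commutative algebra of `Λ = ℤ_p⟦T⟧`, PROVED (as in `mu_isolation_x10b`) -/

/-- **`(p)`-saturation in `Λ`.** If `C` is a nonzero principal ideal of `Λ = ℤ_p⟦T⟧`, `(p)^m · J ⊆ C` for
some `m`, and `C ⊄ (p)`, then `J ⊆ C`. [folklore] -/
theorem le_of_augIdealP_saturation' {p : ℕ} [Fact p.Prime] {J C : Ideal (IwasawaAlgebra p)}
    (hC : C.IsPrincipal) (hC0 : C ≠ ⊥)
    (h1 : ∃ m : ℕ, IwasawaAlgebra.augIdealP p ^ m * J ≤ C)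
    (h2 : ¬ C ≤ IwasawaAlgebra.augIdealP p) :
    J ≤ C := by
  haveI := hC
  obtain ⟨c, hc⟩ := Submodule.IsPrincipal.principal C
  change C = Ideal.span {c} at hc
  set ϖ : IwasawaAlgebra p := PowerSeries.C (p : ℤ_[p]) with hϖdef
  have hp0 : (p : ℤ_[p]) ≠ 0 := Nat.cast_ne_zero.mpr (Fact.out : p.Prime).ne_zero
  have hϖ0 : ϖ ≠ 0 := by
    intro h
    apply hp0
    have h' := congrArg PowerSeries.constantCoeff h
    simpa [hϖdef] using h'
  have haug : IwasawaAlgebra.augIdealP p = Ideal.span {ϖ} := rfl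
  have hϖP : Prime ϖ := (Ideal.span_singleton_prime hϖ0).mp (haug ▸ IwasawaAlgebra.isPrime_augIdealP_holds p)
  have hc0 : c ≠ 0 := by
    rintro rfl
    exact hC0 (by rw [hc, Ideal.span_singleton_eq_bot])
  have hndvd : ¬ ϖ ∣ c := by
    intro hdvd
    apply h2
    rw [hc, haug]
    exact Ideal.span_singleton_le_span_singleton.mpr hdvd
  obtain ⟨m, hm⟩ := h1
  intro j hj
  have h1j : c ∣ ϖ ^ m * j := by
    have hmem : ϖ ^ m * j ∈ C :=
      hm (Ideal.mul_mem_mul (by rw [haug, Ideal.span_singleton_pow]; exact Ideal.mem_span_singleton_self _) hj)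
    rw [hc] at hmem
    exact Ideal.mem_span_singleton.mp hmem
  have hcj : c ∣ j := by
    obtain ⟨x, hx⟩ := h1j
    have hxm : ϖ ^ m ∣ x := hϖP.pow_dvd_of_dvd_mul_left m hndvd ⟨j, by rw [hx]⟩
    obtain ⟨x', rfl⟩ := hxm
    refine ⟨x', mul_left_cancel₀ (pow_ne_zero m hϖP.ne_zero) ?_⟩
    calc ϖ ^ m * j = c * (ϖ ^ m * x') := hx
      _ = ϖ ^ m * (c * x') := by ring
  rw [hc]
  exact Ideal.mem_span_singleton.mpr hcj

/-! ## Composition (kernel-checked, no `sorry`) -/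

/-- **`μ(𝔛_tors) = 0` on (irr_K) frames, the localized containment, and the residue give the crux BY NAME.**
On (irr_K) frames: realise `jbar := IsAlgClosed.lift` along `ιC`, produce the data in the kernel (as
`X10.heegnerContainment_of_cor46_of_not_surj` and `mu_isolation_x10b` do), and saturate at `(3)` with
`C = char_Λ(𝔛_tors)` (principal: `charIdeal_isPrincipal_holds`; nonzero: `Module.charIdeal_ne_bot`) and
`J = char_Λ(𝔖/ℋ_F)²`; on reducible-over-`K` frames: the declared residue. -/
theorem HowardContainmentAnyClassNumberX10b_of_muZeroIrrK
    (hA : Stmt.stub_pLocalizedContainment) (hμ : Stmt.muZeroIrrK) (hres : Stmt.stub_residue_thetaFromK) :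
    Summit.BirchSwinnertonDyer.BirchSwinnertonDyer.Theses.PrintX10b.HowardContainmentAnyClassNumberX10b := by
  unfold Stmt.stub_pLocalizedContainment at hA
  unfold Stmt.muZeroIrrK at hμ
  unfold Stmt.stub_residue_thetaFromK at hres
  intro W _ _ p _ _ K _ _ hX hns hcm hK h3 h4 hHN hHp κ hκ γ hγ Dt H ιC
  by_cases hirr : (W.baseChange K).HasIrreducibleModPGaloisRep p
  · letI : Algebra K ℂ := ιC.toAlgebra
    let jbar : AlgebraicClosure K →+* ℂ :=
      (IsAlgClosed.lift (R := K) (M := ℂ) (S := AlgebraicClosure K)).toRingHom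
    obtain ⟨D⟩ := LambdaAdicSelmerDataExists.nonempty_lambdaAdicSelmerData (W.baseChange K) p κ hγ
    obtain ⟨X⟩ := (W.baseChange K).nonempty_selmerDualData_holds κ γ hγ
    obtain ⟨F⟩ := nonempty_heegnerFamily_of (exists_isHeegnerNormPoint_holds (W.conductorNorm ℤ) W K p)
      hK hHN hX.not_dvd_conductorNorm κ Dt H.dvd_sq_sub jbar
    exact ⟨jbar, D, F, X,
      le_of_augIdealP_saturation' (charIdeal_isPrincipal_holds p _)
        (Module.charIdeal_ne_bot (IwasawaAlgebra p) _)
        (hA W p K hX hns hcm hK h3 h4 hHN hHp κ hκ γ hγ jbar D F X)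
        (hμ W p K hX hns hcm hK h3 h4 hHN hHp hirr κ hκ γ hγ X)⟩
  · exact (hres W p K hX hns hcm hK h3 h4 hHN hHp hirr κ hκ γ hγ Dt H ιC).1

/-- **The line: the six stubs give the crux BY NAME.** -/
theorem HowardContainmentAnyClassNumberX10b_of
    (hA : Stmt.stub_pLocalizedContainment) (hinv : Stmt.stub_residualMuInvariance)
    (hcert : Stmt.stub_cofreeCertificate) (hex : Stmt.stub_partnerExists_nonanomalous)
    (hanomStub : Stmt.stub_partnerMuZero_anomalous) (hres : Stmt.stub_residue_thetaFromK) :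
    Summit.BirchSwinnertonDyer.BirchSwinnertonDyer.Theses.PrintX10b.HowardContainmentAnyClassNumberX10b :=
  HowardContainmentAnyClassNumberX10b_of_muZeroIrrK hA (muZeroIrrK_of_partner hinv hcert hex hanomStub) hres

/-- The composed line from the stubs (sorries only through `stub_*`). -/
theorem HowardContainmentAnyClassNumberX10b_of_stubs :
    Summit.BirchSwinnertonDyer.BirchSwinnertonDyer.Theses.PrintX10b.HowardContainmentAnyClassNumberX10b :=
  HowardContainmentAnyClassNumberX10b_of stub_pLocalizedContainment stub_residualMuInvariance
    stub_cofreeCertificate stub_partnerExists_nonanomalous stub_partnerMuZero_anomalous stub_residue_thetaFromK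


/-! ## Socket to the PIN-1 re-typed deciding crux (rev 21: stmt-BirchSwinnertonDyer-26623) -/

/-- **The `p`-LOCALIZED PINNED containment** (for the frame's own unit-Manin parametrisation, tied
`F.Dt = Dt`): `(p)^m · char_Λ(𝔖/ℋ_F)² ⊆ char_Λ(𝔛_{Λ-tors})` for some `m`. NOT this line's content — it is the
print-mod-typing part of the road of crux 26623 (`3 ∤ h_K`: `X10.heegnerContainmentPinned_of_cor46_of_not_surj`,
p607508, with `m = 0`; `3 ∣ h_K`: CGLS 2022 Thm. 4.1.3 localized = route binder `CGLSHowardDivisibilityLocalized`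
+ the tower binder + the envelope `ℋ_F ⊆ Λκ_∞(C)`, x10b-p2's turnkey), granted the three print binders of
`HowardContainmentAnyClassNumberX10bPinnedOfPrint`. Stated so that THIS line's `μ = 0` plugs into the live
deciding crux by name. [cite: CastellaGrossiLeeSkinner2022, Thm. 4.1.3, Cor. 3.4.2, Rem. 4.1.4 (arXiv:2008.02571)]
[cite: MastellaZerman2026, Cor. 4.6 (arXiv:2505.08710)] [cite: Howard2004HeegnerKolyvagin, Thm. B] -/
def Stmt.pinnedLocalizedContainment : Prop :=
    ∀ (W : WeierstrassCurve ℚ) [W.IsElliptic] [W.IsGloballyMinimal] (p : ℕ) [Fact p.Prime]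
      [NeZero (W.conductorNorm ℤ)] (K : Type) [Field K] [NumberField K],
      ClassX10 W p → ¬ Surj W 3 → ¬ W.HasCM →
      IsImaginaryQuadratic K → NumberField.discr K ≠ -3 → NumberField.discr K ≠ -4 →
      SatisfiesHeegnerHypothesis (W.conductorNorm ℤ) K → SatisfiesHeegnerHypothesis p K →
      ∀ (κ : ZpExtension K p), κ.IsAnticyclotomic → ∀ (γ : Field.absoluteGaloisGroup K),
      κ.IsTopGenerator γ →
      ∀ (Dt : ModularParametrizationData W (W.conductorNorm ℤ))
        (H : HeegnerDatum (W.conductorNorm ℤ) (NumberField.discr K)) (ιC : K →+* ℂ), ¬ (p : ℤ) ∣ Dt.c →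
      ∃ (jbar : AlgebraicClosure K →+* ℂ) (D : (W.baseChange K).LambdaAdicSelmerData κ γ)
        (F : HeegnerFamily (W.conductorNorm ℤ) W K κ jbar) (X : (W.baseChange K).SelmerDualData κ γ),
        F.Dt = Dt ∧ ∃ m : ℕ,
          IwasawaAlgebra.augIdealP p ^ m * heegnerCharIdeal D F ^ 2 ≤
            Module.charIdeal (IwasawaAlgebra p) (Submodule.torsion (IwasawaAlgebra p) X.X)

/-- **The localized pinned containment modulo the three print binders of crux 26623** (print mod typing;
x10b-p2's road — NOT this line's content; a stub only so that the composition below is kernel-checked). -/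
def Stmt.stub_pinnedLocalizedContainmentOfPrint : Prop :=
    Summit.BirchSwinnertonDyer.BirchSwinnertonDyer.Theses.PrintX10b.MastellaZermanHowardDivisibility →
    Summit.BirchSwinnertonDyer.BirchSwinnertonDyer.Theses.PrintX10b.CGLSHowardDivisibilityLocalized →
    Summit.BirchSwinnertonDyer.BirchSwinnertonDyer.Theses.PrintX10b.AnticyclotomicTowerInRingClassFields →
    Stmt.pinnedLocalizedContainment

theorem stub_pinnedLocalizedContainmentOfPrint : Stmt.stub_pinnedLocalizedContainmentOfPrint := by
  sorry

/-- **`μ(𝔛_tors) = 0` on (irr_K) frames + the localized PINNED containment + the residue ⇒ the pinned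
containment** (item 26621, `HowardContainmentAnyClassNumberX10bPinned`) BY NAME — `(p)`-saturation in `Λ`
again on (irr_K) frames, the declared residue elsewhere. -/
theorem HowardContainmentAnyClassNumberX10bPinned_of_muZeroIrrK
    (hloc : Stmt.pinnedLocalizedContainment) (hμ : Stmt.muZeroIrrK) (hres : Stmt.stub_residue_thetaFromK) :
    Summit.BirchSwinnertonDyer.BirchSwinnertonDyer.Theses.PrintX10b.HowardContainmentAnyClassNumberX10bPinned := by
  unfold Stmt.pinnedLocalizedContainment at hloc
  unfold Stmt.muZeroIrrK at hμ
  unfold Stmt.stub_residue_thetaFromK at hres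
  intro W _ _ p _ _ K _ _ hX hns hcm hK h3 h4 hHN hHp κ hκ γ hγ Dt H ιC hc
  by_cases hirr : (W.baseChange K).HasIrreducibleModPGaloisRep p
  · obtain ⟨jbar, D, F, X, hFD, hm⟩ := hloc W p K hX hns hcm hK h3 h4 hHN hHp κ hκ γ hγ Dt H ιC hc
    exact ⟨jbar, D, F, X, hFD,
      le_of_augIdealP_saturation' (charIdeal_isPrincipal_holds p _)
        (Module.charIdeal_ne_bot (IwasawaAlgebra p) _) hm
        (hμ W p K hX hns hcm hK h3 h4 hHN hHp hirr κ hκ γ hγ X)⟩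
  · exact (hres W p K hX hns hcm hK h3 h4 hHN hHp hirr κ hκ γ hγ Dt H ιC).2 hc

/-- **The line plugged into the live deciding crux `HowardContainmentAnyClassNumberX10bPinnedOfPrint`
(stmt-BirchSwinnertonDyer-26623) BY NAME**: the print-mod-typing localized socket + this line's stubs. -/
theorem HowardContainmentAnyClassNumberX10bPinnedOfPrint_of
    (hsock : Stmt.stub_pinnedLocalizedContainmentOfPrint) (hinv : Stmt.stub_residualMuInvariance)
    (hcert : Stmt.stub_cofreeCertificate) (hex : Stmt.stub_partnerExists_nonanomalous)
    (hanomStub : Stmt.stub_partnerMuZero_anomalous) (hres : Stmt.stub_residue_thetaFromK) :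
    Summit.BirchSwinnertonDyer.BirchSwinnertonDyer.Theses.PrintX10b.HowardContainmentAnyClassNumberX10bPinnedOfPrint :=
  fun hMZ hCGLS hTw =>
    HowardContainmentAnyClassNumberX10bPinned_of_muZeroIrrK (hsock hMZ hCGLS hTw)
      (muZeroIrrK_of_partner hinv hcert hex hanomStub) hres

/-- The pinned composed line from the stubs (sorries only through `stub_*`). -/
theorem HowardContainmentAnyClassNumberX10bPinnedOfPrint_of_stubs :
    Summit.BirchSwinnertonDyer.BirchSwinnertonDyer.Theses.PrintX10b.HowardContainmentAnyClassNumberX10bPinnedOfPrint :=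
  HowardContainmentAnyClassNumberX10bPinnedOfPrint_of stub_pinnedLocalizedContainmentOfPrint
    stub_residualMuInvariance stub_cofreeCertificate stub_partnerExists_nonanomalous stub_partnerMuZero_anomalous
    stub_residue_thetaFromK

end Summit.BirchSwinnertonDyer.BirchSwinnertonDyer.Cruxes.HowardContainmentAnyClassNumberX10b.CongruentPartnerMuX10b

end
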